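import Summits.Ventures.QEC.Census.CertCoverBatch
import Summits.Ventures.QEC.Census.TwoBGA.TB_l6m24_A0_0_0_1_3_11_B0_0_1_11_5_4.CoreDefs
import HarnessLib

set_option Elab.async false
set_option maxRecDepth 200000

/-!
# `[[288,12,16]]` one-level cover certificate of `TB_l6m24_A0_0_0_1_3_11_B0_0_1_11_5_4` — LEVEL-1→0 coset problems 81…93 (deep problems [5] excluded: `ProbDeep*.lean`) as COMPACT data
(`ProbData`: U, f, σ, y₀, allow; qec-type-10 `CertCoverBatch.mkCoset` rebuilds each `CosetProb` in the kernel) + their verdict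
`probsOK cov covR hx hx1 D1 lxd 14` (one `decide +kernel`; 13 problems, depths f=0:12 f=1:1 f=2:0 f=3:0, est. 50.0 s).
qec-search-1 g5 (pattern of search-9 g5 `Probs*`); data from JSON `level10.problems` (sha256 fee0559d1bce5e88…). Data + decided check; KERNEL.
-/

namespace Summit.Ventures.QEC.Census.TB_l6m24_A0_0_0_1_3_11_B0_0_1_11_5_4

open Matrix Summit.Ventures.QEC.Census Literature.InformationTheory.QuantumCodes

/-- Problems 81…93 (13): `⟨U, f, σ, y₀, allow⟩`. -/
def probs06b : List ProbData := [
    ⟨3988333044298124045074148876771921922, 0, 2306406100910475266, 649037136331075430160421448847360, [0]⟩,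
    ⟨3988982081395778939009606903920594945, 0, 6918092256778911746, 1298074233976524632652709307092992, [0]⟩,
    ⟨3992876304039722574864408658246111243, 0, 27670680164328538114, 3992876304020323093352780155708243971, [0]⟩,
    ⟨3998068600898314089337477664035831827, 0, 55340234424455266306, 3998068600878857939428054725755404291, [0]⟩,
    ⟨4018837788332944489073460240841707523, 0, 562957478035586, 3987684007162392710187312898117730307, [0]⟩,
    ⟨4049991569484757917755580829210251267, 0, 562952109359362, 3987684007162997173097120210557599747, [0]⟩,
    ⟨9335749811222090110208191109267456001, 0, 1770887431903971901568, 1329228055361385907014161371563556865, [0]⟩,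
    ⟨11968244318460013134988590163561562113, 0, 27672369035672027148, 10633823966279383651628250935165190144, [0]⟩,
    ⟨65132820891236932679656157238336159744, 0, 2305849743790835712, 63803592834792950159402229438151131136, [0]⟩,
    ⟨5447177868229348562928710699345629937664, 0, 6918092256778911746, 2658456031183927170039231530563272704, [0]⟩,
    ⟨5447238877717437541907456655678733549570, 1, 562952109359362, 2658456031185121928759397546507370498, [0]⟩,
    ⟨5460531157635962763937251059225510023168, 0, 3541774863807943803136, 5460531157635652067640426856988981334016, [0]⟩,
    ⟨5572125299795973110985399640277907410946, 0, 6917542496796409856, 5444518114126406553479709015468400447490, [0]⟩]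

set_option maxHeartbeats 400000000 in
/-- Every problem of this chunk passes (`mkCoset` elimination + `cosetOKD` + fast `σ` + depth + `BU`-evenness + label checks). -/
theorem probs06b_ok : probsOK TB_l6m24_A0_0_0_1_3_11_B0_0_1_11_5_4.cov covR hx hx1 D1 lxd 14 probs06b = true := by
  decide +kernel

/-- Pointwise form. -/
theorem probs06b_all : ∀ x ∈ probs06b, probOK TB_l6m24_A0_0_0_1_3_11_B0_0_1_11_5_4.cov covR hx hx1 D1 lxd 14 x = true := by
  have h := probs06b_ok
  rwa [probsOK, List.all_eq_true] at h

end Summit.Ventures.QEC.Census.TB_l6m24_A0_0_0_1_3_11_B0_0_1_11_5_4
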